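import Summits.CriticalPhenomena.SAWScalingLimit.Theorems.SAWSpinMonotoneQCIdentificationNoBranchingAlgebra

/-!
# (Q) Second-order closedness of Smirnov's spin-`5/8` primitive

Helper sub-goal of `stub_rayCondition` (line `eight_fifths_primitive`, crux
stmt-CriticalPhenomena-16772, wave 2).  Pure complex analysis, no lattice objects.

With `ω = e^{2πi/3}` and principal powers, the circulation of `F^{8/5} dz` around a dual lattice
triangle whose three port values are `F_k = (S/3)(1 + ω^k a')` is proportional to
`(S/3)^{8/5} φ(a')`, where

`φ(u) = Σ_{k=0,1,2} ω^k (1 + ω^k u)^{8/5}`.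

We prove that `φ` is holomorphic on the open unit disc, `φ(0) = 0`, `φ'(0) = 0` (the linear term is
killed by `1 + ω + ω² = 0`, resp. `1 + ω² + ω⁴ = 0`), and the quadratic bound

`‖φ(u)‖ ≤ 3 · 2^{8/5} · ‖u‖²` for `‖u‖ < 1`

(explicit constant `3 · 2^{8/5} ≈ 9.09`), by the second-order Schwarz lemma
(`Complex.dist_le_mul_div_pow_of_mapsTo_ball_of_isLittleO` with `n = 1`, radius `1`, and the sup bound
`‖φ‖ ≤ 3 · 2^{8/5}` on the disc).  Since `2^{8/5} r² ≤ (1 + r)^{8/5}` for `0 < r ≤ 1`, this also gives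
the form `‖φ(u)‖ ≤ 3 (1 + r)^{8/5} / r² · ‖u‖²` on `‖u‖ ≤ r < 1`.

The root of unity is the landed `NB.omg` of `SAWSpinMonotoneQCIdentificationNoBranchingAlgebra`
(same crux, same line), reused rather than redefined.

Source of the statement: S. Smirnov, *Towards conformal invariance of 2D lattice models*, ICM 2006
(arXiv:0708.0032) §5.6; H. Duminil-Copin, S. Smirnov, Ann. of Math. 175 (2012), Lemma 1.
-/

noncomputable section

open Complex Metric Set Filter
open scoped Topology

namespace Summit.CriticalPhenomena.SAWScalingLimit.Cruxes.QCIdentification.EightFifthsPrimitive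

namespace P85

/-! The cube root of unity `ω = e^{2πi/3}` of the route statement (K) is the landed
`NB.omg : ℂ := Complex.exp (2 * Real.pi * I / 3)` of the sibling helper module
`SAWSpinMonotoneQCIdentificationNoBranchingAlgebra` (with `1 + ω + ω² = 0`, `ω³ = 1`, `‖ω‖ = 1`). -/
open NB (omg one_add_omg_add_sq omg_pow_three norm_omg)

/-- Smirnov's spin-`5/8` circulation function `φ(u) = Σ_k ω^k (1 + ω^k u)^{8/5}` (principal powers,
`ω = NB.omg = e^{2πi/3}`). -/
def circ (u : ℂ) : ℂ := ∑ k : Fin 3, omg ^ (k : ℕ) * (1 + omg ^ (k : ℕ) * u) ^ ((8 : ℂ) / 5)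

/-- `‖ω ^ n‖ = 1`. -/
theorem norm_omg_pow (n : ℕ) : ‖omg ^ n‖ = 1 := by
  rw [norm_pow, norm_omg, one_pow]

/-- `φ(0) = 1 + ω + ω² = 0`. -/
theorem p85_circ_zero : circ 0 = 0 := by
  have h : circ 0 = 1 + omg + omg ^ 2 := by
    simp [circ, Fin.sum_univ_three]
  rw [h, one_add_omg_add_sq]

/-- The derivative of `φ` on the open unit disc (each `1 + ω^k u` lies in the slit plane). -/
theorem hasDerivAt_circ {u : ℂ} (hu : ‖u‖ < 1) :
    HasDerivAt circ (∑ k : Fin 3, omg ^ (k : ℕ) *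
      ((8 : ℂ) / 5 * (1 + omg ^ (k : ℕ) * u) ^ ((8 : ℂ) / 5 - 1) * omg ^ (k : ℕ))) u := by
  have hc : circ = fun u => ∑ k : Fin 3, omg ^ (k : ℕ) * (1 + omg ^ (k : ℕ) * u) ^ ((8 : ℂ) / 5) :=
    rfl
  rw [hc]
  refine HasDerivAt.fun_sum fun k _ => ?_
  have hmem : 1 + omg ^ (k : ℕ) * u ∈ Complex.slitPlane :=
    Complex.mem_slitPlane_of_norm_lt_one (by rwa [norm_mul, norm_omg_pow, one_mul])
  have hlin : HasDerivAt (fun u : ℂ => 1 + omg ^ (k : ℕ) * u) (omg ^ (k : ℕ)) u := by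
    simpa using ((hasDerivAt_id u).const_mul (omg ^ (k : ℕ))).const_add 1
  exact (hlin.cpow_const hmem).const_mul _

/-- `φ` is holomorphic on the open unit disc. -/
theorem p85_circ_differentiableOn : DifferentiableOn ℂ circ (Metric.ball 0 1) := fun u hu =>
  (hasDerivAt_circ (by simpa using hu)).differentiableAt.differentiableWithinAt

/-- `φ'(0) = (8/5)(1 + ω² + ω⁴) = 0`: the linear term of the circulation vanishes. -/
theorem p85_deriv_circ_zero : deriv circ 0 = 0 := by
  rw [(hasDerivAt_circ (u := 0) (by simp)).deriv]
  simp only [mul_zero, add_zero, Complex.one_cpow, mul_one, Fin.sum_univ_three, Fin.val_zero,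
    Fin.val_one, Fin.val_two, pow_zero, pow_one, one_mul]
  linear_combination (8 / 5 : ℂ) * one_add_omg_add_sq + (8 / 5 : ℂ) * omg * omg_pow_three

/-- Sup bound on the closed unit disc: `‖φ(w)‖ ≤ 3 · 2^{8/5}`. -/
theorem norm_circ_le_of_norm_le_one {w : ℂ} (hw : ‖w‖ ≤ 1) :
    ‖circ w‖ ≤ 3 * 2 ^ ((8 : ℝ) / 5) := by
  have hexp : ((8 : ℂ) / 5) = ((8 / 5 : ℝ) : ℂ) := by norm_num
  unfold circ
  calc ‖∑ k : Fin 3, omg ^ (k : ℕ) * (1 + omg ^ (k : ℕ) * w) ^ ((8 : ℂ) / 5)‖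
      ≤ ∑ k : Fin 3, ‖omg ^ (k : ℕ) * (1 + omg ^ (k : ℕ) * w) ^ ((8 : ℂ) / 5)‖ := norm_sum_le _ _
    _ ≤ ∑ _k : Fin 3, (2 : ℝ) ^ ((8 : ℝ) / 5) := by
        refine Finset.sum_le_sum fun k _ => ?_
        rw [norm_mul, norm_omg_pow, one_mul, hexp, Complex.norm_cpow_real]
        refine Real.rpow_le_rpow (norm_nonneg _) ?_ (by norm_num)
        calc ‖1 + omg ^ (k : ℕ) * w‖ ≤ ‖(1 : ℂ)‖ + ‖omg ^ (k : ℕ) * w‖ := norm_add_le _ _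
          _ = 1 + ‖w‖ := by rw [norm_one, norm_mul, norm_omg_pow, one_mul]
          _ ≤ 2 := by linarith
    _ = 3 * 2 ^ ((8 : ℝ) / 5) := by simp

/-- **Second-order closedness, uniform form.** `‖φ(u)‖ ≤ 3 · 2^{8/5} ‖u‖²` on the open unit disc
(second-order Schwarz lemma at radius `1`). -/
theorem p85_norm_circ_le_unif : ∀ u : ℂ, ‖u‖ < 1 → ‖circ u‖ ≤ 3 * 2 ^ ((8 : ℝ) / 5) * ‖u‖ ^ 2 := by
  intro u hu
  have hmaps : Set.MapsTo circ (Metric.ball 0 1)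
      (Metric.closedBall (circ 0) (3 * 2 ^ ((8 : ℝ) / 5))) := by
    intro w hw
    rw [p85_circ_zero, Metric.mem_closedBall, dist_zero_right]
    exact norm_circ_le_of_norm_le_one (le_of_lt (by simpa using hw))
  have hder : HasDerivAt circ 0 0 := by
    have h := (hasDerivAt_circ (u := 0) (by simp)).differentiableAt.hasDerivAt
    rwa [p85_deriv_circ_zero] at h
  have hlo : (fun w => circ w - circ 0) =o[𝓝 0] (fun w => ‖w - 0‖ ^ 1) := by
    simpa using (hasDerivAt_iff_isLittleO.1 hder).norm_right
  have key := Complex.dist_le_mul_div_pow_of_mapsTo_ball_of_isLittleO (n := 1) (z := u)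
    p85_circ_differentiableOn hmaps hlo (by simpa using hu)
  simpa [p85_circ_zero] using key

/-- The elementary inequality `2^{8/5} r² ≤ (1 + r)^{8/5}` for `0 < r ≤ 1`. -/
theorem two_rpow_mul_sq_le {r : ℝ} (hr : 0 < r) (hr1 : r ≤ 1) :
    (2 : ℝ) ^ ((8 : ℝ) / 5) * r ^ 2 ≤ (1 + r) ^ ((8 : ℝ) / 5) := by
  have h2 : r ^ 2 ≤ r ^ ((8 : ℝ) / 5) := by
    have := Real.rpow_le_rpow_of_exponent_ge hr hr1 (show (8 : ℝ) / 5 ≤ 2 by norm_num)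
    rwa [Real.rpow_two] at this
  calc (2 : ℝ) ^ ((8 : ℝ) / 5) * r ^ 2 ≤ 2 ^ ((8 : ℝ) / 5) * r ^ ((8 : ℝ) / 5) := by gcongr
    _ = (2 * r) ^ ((8 : ℝ) / 5) := by rw [Real.mul_rpow (by norm_num) hr.le]
    _ ≤ (1 + r) ^ ((8 : ℝ) / 5) := Real.rpow_le_rpow (by positivity) (by linarith) (by norm_num)

/-- **Second-order closedness (Q).** For `‖u‖ ≤ r < 1`,
`‖φ(u)‖ ≤ 3 (1 + r)^{8/5} / r² · ‖u‖²`: the circulation of `F^{8/5} dz` around a lattice triangle is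
quadratic in the Beltrami ratio. -/
theorem p85_norm_circ_le : ∀ r : ℝ, 0 < r → r < 1 → ∀ u : ℂ, ‖u‖ ≤ r →
    ‖circ u‖ ≤ (3 * (1 + r) ^ ((8 : ℝ) / 5) / (r ^ 2)) * ‖u‖ ^ 2 := by
  intro r hr hr1 u hu
  refine (p85_norm_circ_le_unif u (lt_of_le_of_lt hu hr1)).trans
    (mul_le_mul_of_nonneg_right ?_ (sq_nonneg _))
  rw [le_div_iff₀ (by positivity)]
  have key := two_rpow_mul_sq_le hr hr1.le
  calc 3 * (2 : ℝ) ^ ((8 : ℝ) / 5) * r ^ 2 = 3 * (2 ^ ((8 : ℝ) / 5) * r ^ 2) := by ring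
    _ ≤ 3 * (1 + r) ^ ((8 : ℝ) / 5) := by gcongr

end P85

end Summit.CriticalPhenomena.SAWScalingLimit.Cruxes.QCIdentification.EightFifthsPrimitive
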